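import Mathlib
import Literature.Probability.LatticeModels.GKSInequalities
import HarnessLib

/-!
# Crux `PrecisionLaplacian.InverseMFerromagnet` (stmt-CriticalPhenomena-4798), line `Sketch` —
# stub `stub_entry_nonpos_of_pcov` (S1, the Schur step)

THEOREM-ONLY file (no definitions).  Let `G = (⟨σ_pσ_q⟩)_{p,q}` be the spin second-moment matrix
of the zero-field model `gksExpect univ K C`, let `x ≠ y`, `S = univ ∖ {x,y}`, and let
`PCov(x,y|S) = G_xy − G_{xS} (G_SS)⁻¹ G_{Sy}` be the partial covariance (the `xy` entry of the
Schur complement `M` of the block `G_SS` in `G`).  This file proves the pure linear-algebra step of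
the line (`InverseMFerromagnet_of`, last line):

  `PCov(x,y|S) ≥ 0 ⟹ (G⁻¹)_xy ≤ 0`.

Proof.  `G` is positive definite (`vᵀGv = ⟨(∑ v_pσ_p)²⟩ > 0` for `v ≠ 0`, tested on the
configuration `σ_p = sign v_p`; the argument is adapted from the refuter's record
`Cruxes/InverseMFerromagnet/Disproof.lean`, which is not importable), hence so are the principal
block `D = G_SS` and `Γ = G⁻¹`.  Reading `Γ G = 1` entrywise and eliminating the `S`-part of a row
`i ∈ {x,y}` of `Γ` with `D⁻¹` gives `Γ_ix M_xy + Γ_iy M_yy = δ_iy`, i.e.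
`Γ_xx M_xy + Γ_xy M_yy = 0` and `Γ_xy M_xy + Γ_yy M_yy = 1` (`Γ` is symmetric), whence
`Γ_xy = −(Γ_xx Γ_yy − Γ_xy²) M_xy ≤ 0` because the `{x,y}`-block of `Γ` has positive determinant.
No sign hypothesis on the couplings is needed for this step.
-/

namespace Summit.CriticalPhenomena.Ising3DConformalLimit.Cruxes.InverseMFerromagnet.PartialCovarianceLadder

open Literature.Probability.LatticeModels Finset Matrix

/-! ## Positive definiteness of the second-moment matrix `(⟨σ_pσ_q⟩)` -/

/-- `⟨·⟩` is additive over finite sums. [folklore] -/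
theorem schur_gksExpect_finset_sum {Λ ι α : Type*} [Fintype Λ] [DecidableEq Λ] (s : Finset ι)
    (K : ι → ℝ) (C : ι → Finset Λ) (T : Finset α) (g : α → SpinConfig Λ → ℝ) :
    gksExpect s K C (fun ω => ∑ a ∈ T, g a ω) = ∑ a ∈ T, gksExpect s K C (g a) := by
  unfold gksExpect gksSum
  rw [← Finset.sum_div]
  congr 1
  simp_rw [Finset.sum_mul]
  rw [Finset.sum_comm]

/-- `⟨c f⟩ = c ⟨f⟩`. [folklore] -/
theorem schur_gksExpect_const_mul {Λ ι : Type*} [Fintype Λ] [DecidableEq Λ] (s : Finset ι)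
    (K : ι → ℝ) (C : ι → Finset Λ) (c : ℝ) (f : SpinConfig Λ → ℝ) :
    gksExpect s K C (fun ω => c * f ω) = c * gksExpect s K C f := by
  unfold gksExpect gksSum
  simp_rw [mul_assoc]
  rw [← Finset.mul_sum, mul_div_assoc]

/-- `⟨f⟩ > 0` for a nonnegative `f` that is positive somewhere (every configuration has positive
weight). [folklore] -/
theorem schur_gksExpect_pos_of_nonneg {Λ ι : Type*} [Fintype Λ] [DecidableEq Λ] (s : Finset ι)
    (K : ι → ℝ) (C : ι → Finset Λ) {f : SpinConfig Λ → ℝ} (hf : ∀ ω, 0 ≤ f ω)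
    (ω₀ : SpinConfig Λ) (h0 : 0 < f ω₀) : 0 < gksExpect s K C f := by
  unfold gksExpect
  refine div_pos ?_ (gksSum_one_pos s K C)
  unfold gksSum
  apply Finset.sum_pos'
  · intro ω _; exact mul_nonneg (hf ω) (gksWeight_pos s K C ω).le
  · exact ⟨ω₀, Finset.mem_univ _, mul_pos h0 (gksWeight_pos s K C ω₀)⟩

/-- The quadratic form of `G = (⟨σ_pσ_q⟩)` is the second moment of the linear spin functional
`∑ v_p σ_p`: `vᵀGv = ⟨(∑ v_pσ_p)²⟩`. [folklore] -/
theorem schur_quadForm (n m : ℕ) (K : Fin m → ℝ) (C : Fin m → Finset (Fin n)) (v : Fin n → ℝ) :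
    dotProduct v ((Matrix.of fun p q : Fin n =>
        gksExpect Finset.univ K C (fun ω => spinAt p ω * spinAt q ω)).mulVec v) =
      gksExpect Finset.univ K C (fun ω => (∑ p, v p * spinAt p ω) ^ 2) := by
  have hsq : (fun ω : SpinConfig (Fin n) => (∑ p, v p * spinAt p ω) ^ 2)
      = fun ω => ∑ p, ∑ q, (v p * v q) * (spinAt p ω * spinAt q ω) := by
    funext ω
    rw [sq, Finset.sum_mul_sum]
    refine Finset.sum_congr rfl fun p _ => Finset.sum_congr rfl fun q _ => by ring
  rw [hsq, schur_gksExpect_finset_sum]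
  simp only [dotProduct, Matrix.mulVec, Matrix.of_apply]
  refine Finset.sum_congr rfl fun p _ => ?_
  rw [schur_gksExpect_finset_sum, Finset.mul_sum]
  refine Finset.sum_congr rfl fun q _ => ?_
  rw [schur_gksExpect_const_mul]
  ring

/-- **The second-moment matrix `G = (⟨σ_pσ_q⟩)` is positive definite** (for every `n, K, C`, no
sign hypothesis): `vᵀGv = ⟨(∑ v_pσ_p)²⟩ > 0` for `v ≠ 0`, testing on the configuration
`σ_p = sign v_p`, where the integrand is `(∑ |v_p|)² > 0`. [folklore] -/
theorem schur_posDef (n m : ℕ) (K : Fin m → ℝ) (C : Fin m → Finset (Fin n)) :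
    (Matrix.of fun p q : Fin n =>
        gksExpect Finset.univ K C (fun ω => spinAt p ω * spinAt q ω)).PosDef := by
  rw [Matrix.posDef_iff_dotProduct_mulVec]
  refine ⟨?_, fun v hv => ?_⟩
  · refine Matrix.IsHermitian.ext fun p q => ?_
    simp only [Matrix.of_apply, star_trivial]
    exact congrArg _ (funext fun ω => mul_comm _ _)
  · simp only [star_trivial]
    rw [schur_quadForm]
    -- test configuration `σ_p = sign v_p`
    let ω₀ : SpinConfig (Fin n) := fun p => if 0 ≤ v p then 1 else -1
    have hterm : ∀ p, v p * spinAt p ω₀ = |v p| := by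
      intro p
      by_cases hp : 0 ≤ v p
      · simp [ω₀, spinAt, hp, abs_of_nonneg hp]
      · simp [ω₀, spinAt, hp, abs_of_neg (lt_of_not_ge hp)]
    refine schur_gksExpect_pos_of_nonneg _ _ _ (fun ω => sq_nonneg _) ω₀ ?_
    simp_rw [hterm]
    obtain ⟨p, hp⟩ : ∃ p, v p ≠ 0 := by
      by_contra hall
      push Not at hall
      exact hv (funext hall)
    have : 0 < ∑ q, |v q| :=
      Finset.sum_pos' (fun q _ => abs_nonneg _) ⟨p, Finset.mem_univ _, abs_pos.mpr hp⟩
    positivity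

/-! ## The Schur step (pure linear algebra on a positive definite matrix) -/

/-- Splitting a sum over `Fin n` into the two points `x ≠ y` and the rest `S = univ ∖ {x,y}`
(summed over the subtype `↥S`). [folklore] -/
theorem schur_sum_split {n : ℕ} {x y : Fin n} {S : Finset (Fin n)} (hxy : x ≠ y)
    (hS : S = (Finset.univ.erase x).erase y) (f : Fin n → ℝ) :
    ∑ k, f k = f x + f y + ∑ k : ↥S, f k.1 := by
  rw [Finset.sum_coe_sort S f, hS, add_assoc,
    Finset.add_sum_erase _ _ (Finset.mem_erase.2 ⟨hxy.symm, Finset.mem_univ y⟩),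
    Finset.add_sum_erase _ _ (Finset.mem_univ x)]

/-- The `{x,y}`-block of a positive definite matrix has positive determinant. [folklore] -/
theorem schur_det_two_pos {n : ℕ} {Γ : Matrix (Fin n) (Fin n) ℝ} (hΓ : Γ.PosDef) {x y : Fin n}
    (hxy : x ≠ y) : 0 < Γ x x * Γ y y - Γ x y * Γ y x := by
  have hinj : Function.Injective ![x, y] := by
    intro a b hab
    fin_cases a <;> fin_cases b
    · rfl
    · exact absurd (by simpa using hab) hxy
    · exact absurd (by simpa using hab) hxy.symm
    · rfl
  have h2 := (hΓ.submatrix hinj).det_pos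
  rw [Matrix.det_fin_two] at h2
  simpa [Matrix.submatrix_apply] using h2

/-- **Schur step.** For a positive definite real matrix `G` on `Fin n`, `x ≠ y` and
`S = univ ∖ {x,y}`: if the partial covariance `G_xy − ∑_{p,q ∈ S} G_xp ((G_SS)⁻¹)_pq G_qy` is
`≥ 0`, then `(G⁻¹)_xy ≤ 0`.  (Eliminating the `S`-part of the rows `x, y` of `Γ = G⁻¹` from
`Γ G = 1` gives `Γ_xx M_xy + Γ_xy M_yy = 0`, `Γ_xy M_xy + Γ_yy M_yy = 1` for the Schur complement
`M`, so `Γ_xy = −(Γ_xxΓ_yy − Γ_xy²) M_xy`.) [folklore] -/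
theorem schur_inv_entry_nonpos {n : ℕ} (G : Matrix (Fin n) (Fin n) ℝ) (hG : G.PosDef)
    (x y : Fin n) (S : Finset (Fin n)) (hxy : x ≠ y) (hS : S = (Finset.univ.erase x).erase y)
    (hM : 0 ≤ G x y - ∑ p : ↥S, ∑ q : ↥S,
      G x p.1 * (G.submatrix (Subtype.val : ↥S → Fin n) (Subtype.val : ↥S → Fin n))⁻¹ p q
        * G q.1 y) :
    G⁻¹ x y ≤ 0 := by
  have hxS : x ∉ S := by rw [hS]; simp
  have hyS : y ∉ S := by rw [hS]; simp
  set D : Matrix ↥S ↥S ℝ :=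
    G.submatrix (Subtype.val : ↥S → Fin n) (Subtype.val : ↥S → Fin n) with hD
  set Γ : Matrix (Fin n) (Fin n) ℝ := G⁻¹
  have hDpd : D.PosDef := hG.submatrix Subtype.val_injective
  have hΓpd : Γ.PosDef := hG.inv
  have hΓG : Γ * G = 1 :=
    Matrix.nonsing_inv_mul G ((Matrix.isUnit_iff_isUnit_det G).mp hG.isUnit)
  have hDD : D * D⁻¹ = 1 :=
    Matrix.mul_nonsing_inv D ((Matrix.isUnit_iff_isUnit_det D).mp hDpd.isUnit)
  -- the entries of `Γ G = 1`, with the sum split along `{x} ∪ {y} ∪ S`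
  have hE : ∀ i j, Γ i x * G x j + Γ i y * G y j + ∑ k : ↥S, Γ i k.1 * G k.1 j
      = (1 : Matrix (Fin n) (Fin n) ℝ) i j := by
    intro i j
    have h := congrFun (congrFun hΓG i) j
    rw [Matrix.mul_apply, schur_sum_split hxy hS] at h
    exact h
  -- the `S`-part of a row `i ∉ S` of `Γ`, eliminated with `D⁻¹`
  have hrow : ∀ i, i ∉ S → ∀ q : ↥S,
      Γ i q.1 = -∑ p : ↥S, (Γ i x * G x p.1 + Γ i y * G y p.1) * D⁻¹ p q := by
    intro i hi q
    have h1 : (fun p : ↥S => Γ i p.1) ᵥ* D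
        = -(fun p : ↥S => Γ i x * G x p.1 + Γ i y * G y p.1) := by
      funext j
      have hij : i ≠ j.1 := fun h => hi (h ▸ j.2)
      have h := hE i j.1
      rw [Matrix.one_apply_ne hij] at h
      simp only [Matrix.vecMul, dotProduct, Pi.neg_apply, hD, Matrix.submatrix_apply]
      linarith
    have h2 : (fun p : ↥S => Γ i p.1)
        = -((fun p : ↥S => Γ i x * G x p.1 + Γ i y * G y p.1) ᵥ* D⁻¹) := by
      calc (fun p : ↥S => Γ i p.1) = ((fun p : ↥S => Γ i p.1) ᵥ* D) ᵥ* D⁻¹ := by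
            rw [Matrix.vecMul_vecMul, hDD, Matrix.vecMul_one]
        _ = _ := by rw [h1, Matrix.neg_vecMul]
    have h3 := congrFun h2 q
    simp only [Pi.neg_apply, Matrix.vecMul, dotProduct] at h3
    exact h3
  -- the column-`y` equations `Γ_ix M_xy + Γ_iy M_yy = δ_iy` for `i ∉ S`
  have hcol : ∀ i, i ∉ S →
      Γ i x * (G x y - ∑ p : ↥S, ∑ q : ↥S, G x p.1 * D⁻¹ p q * G q.1 y)
        + Γ i y * (G y y - ∑ p : ↥S, ∑ q : ↥S, G y p.1 * D⁻¹ p q * G q.1 y)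
        = (1 : Matrix (Fin n) (Fin n) ℝ) i y := by
    intro i hi
    have hsum : ∑ k : ↥S, Γ i k.1 * G k.1 y
        = -(Γ i x) * (∑ p : ↥S, ∑ q : ↥S, G x p.1 * D⁻¹ p q * G q.1 y)
          + -(Γ i y) * (∑ p : ↥S, ∑ q : ↥S, G y p.1 * D⁻¹ p q * G q.1 y) := by
      calc ∑ k : ↥S, Γ i k.1 * G k.1 y
          = ∑ k : ↥S, ∑ p : ↥S, (-(Γ i x) * (G x p.1 * D⁻¹ p k * G k.1 y)
              + -(Γ i y) * (G y p.1 * D⁻¹ p k * G k.1 y)) := by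
            refine Finset.sum_congr rfl fun k _ => ?_
            rw [hrow i hi k, ← Finset.sum_neg_distrib, Finset.sum_mul]
            exact Finset.sum_congr rfl fun p _ => by ring
        _ = ∑ p : ↥S, ∑ k : ↥S, (-(Γ i x) * (G x p.1 * D⁻¹ p k * G k.1 y)
              + -(Γ i y) * (G y p.1 * D⁻¹ p k * G k.1 y)) := Finset.sum_comm
        _ = _ := by simp only [Finset.sum_add_distrib, Finset.mul_sum]
    rw [← hE i y, hsum]
    ring
  have ex := hcol x hxS
  have ey := hcol y hyS
  rw [Matrix.one_apply_ne hxy] at ex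
  rw [Matrix.one_apply_eq] at ey
  -- symmetry of `Γ` and positivity of the determinant of its `{x,y}`-block
  have hsym : Γ y x = Γ x y := by
    have h := hΓpd.isHermitian.apply x y
    simpa using h
  have hdet : 0 < Γ x x * Γ y y - Γ x y * Γ x y := by
    have h := schur_det_two_pos hΓpd hxy
    rwa [hsym] at h
  rw [hsym] at ey
  have hfin : Γ x y = -((Γ x x * Γ y y - Γ x y * Γ x y)
      * (G x y - ∑ p : ↥S, ∑ q : ↥S, G x p.1 * D⁻¹ p q * G q.1 y)) := by
    linear_combination Γ y y * ex - Γ x y * ey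
  rw [hfin]
  exact neg_nonpos.mpr (mul_nonneg hdet.le hM)

/-! ## The registered stub -/

/-- Registered stub `stub_entry_nonpos_of_pcov` (S1, the Schur step of line `Sketch`): for the
spin second-moment matrix `G = (⟨σ_pσ_q⟩)` of a zero-field pair ferromagnet, `x ≠ y` and
`S = univ ∖ {x,y}`, nonnegativity of the partial covariance
`G_xy − ∑_{p,q ∈ S} G_xp ((G_SS)⁻¹)_pq G_qy` forces `(G⁻¹)_xy ≤ 0`.  Pure linear algebra on the
positive definite matrix `G` (`schur_posDef`, `schur_inv_entry_nonpos`); the hypotheses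
`0 ≤ K i` and `|C i| = 2` are not used. [folklore] -/
theorem stub_entry_nonpos_of_pcov : ∀ (n m : ℕ) (K : Fin m → ℝ) (C : Fin m → Finset (Fin n)), (∀ i, 0 ≤ K i) → (∀ i, (C i).card = 2) → ∀ G : Matrix (Fin n) (Fin n) ℝ, G = Matrix.of (fun p q : Fin n => gksExpect Finset.univ K C (fun ω => spinAt p ω * spinAt q ω)) → ∀ (x y : Fin n) (S : Finset (Fin n)), x ≠ y → S = (Finset.univ.erase x).erase y → 0 ≤ G x y - ∑ p : ↥S, ∑ q : ↥S, G x p.1 * (G.submatrix (Subtype.val : ↥S → Fin n) (Subtype.val : ↥S → Fin n))⁻¹ p q * G q.1 y → G⁻¹ x y ≤ 0 := by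
  intro n m K C _hK _hC G hG x y S hxy hS hM
  have hPD : G.PosDef := by
    rw [hG]
    exact schur_posDef n m K C
  exact schur_inv_entry_nonpos G hPD x y S hxy hS hM

end Summit.CriticalPhenomena.Ising3DConformalLimit.Cruxes.InverseMFerromagnet.PartialCovarianceLadder
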